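import Summits.Ventures.PercRepro.S1ChainCoNullCells
import Summits.Ventures.PercRepro.S1KillCellTenFive
import Summits.Ventures.PercRepro.S1SeriesLever

/-!
# PercRepro — THE CELL `(10, 8)` OF THE `q = 4` WINDOW BY THE CO-NULLITY CREDIT (p2, gen 24; SUBCLAIM-S1 §6.9)

The cell `(10, 8)` (`18` points; open at `t = 13` under the chain levers with the per-pair kill: short by `2581` on
the lines with two or three points outside the chain union): the coloop-free case at the actual triangle count
`t = s₃ ≤ 13` on the lever caps `(t, 73, 555)` by the per-pair chain lines with the co-nullity credit and
`r = 1 (t ≤ 7), 6 (t = 8, 9, 10), 7 (t = 11, 12, 13)` — at `r = 7` the exclusion level is `k = 2`, and every set of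
size `≥ 11` avoiding two points outside the chain union is a `Y`-set the form never counted (`Σ_{j≥11} C(16, j) = 6885`
of them when `≥ 2` points lie outside); the last line (`t = 13`, `u = 17`, one point outside) closes on the per-pair
kill alone with margin `≈ 2803`. One coloop (`p = 9` on `17` points, caps `13 / 79 / 568`) and two coloops (`p = 8`
on `16`, `13 / 88 / 583`) with `r = 1`; `c ≥ 3` lossy. Exact-integer twin mining/p2/g24/lines108.py.

* `gb_cap_eight` — the series-class cap `gb 8 n` instantiated; `rrTenEight0`, `rrTenEight1` — the chain lengths per `t`;
* **`c025_core_ten_eight`**.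
Axioms: standard.
-/

open scoped Matroid

namespace PercRepro

namespace S1

open Set

variable {α : Type}

/-- **The series-class cap at `(10, 18)`, `(9, 17)`, `(8, 16)`** (nullity `8`): `s₄ ≤ gb 8 n` on the coloop-free part. -/
theorem gb_cap_eight (p n S : ℕ) (hn : n = p + 8) (hv : gb 8 n = S) : ∀ (N : Matroid α) [N.Finite],
    (∀ e ∈ N.E, ∃ A ⊆ N.E \ {e}, e ∉ N.closure A ∧ e ∉ N.closure ((N.E \ {e}) \ A)) →
    N.E.encard = N.eRank + ((8 : ℕ) : ℕ∞) → N.E.ncard = p + 8 → N.coloops = ∅ →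
    {C : Set α | N.IsCircuit C ∧ C.ncard = 4}.ncard ≤ S := by
  intro N _ hfree hd hn' hcol
  have h := ncard_fourCircuits_le_gb_of_coloopFree N hfree hd hcol hn'
  rwa [← hn, hv] at h

/-- The chain length `r` at each `t = s₃` (coloop-free case): `1` for `t ≤ 7`, `6` for `t = 8, 9, 10`, `7` beyond. -/
def rrTenEight0 (t : ℕ) : ℕ := [0, 1, 1, 1, 1, 1, 1, 1, 6, 6, 6, 7, 7, 7].getD t 0

/-- The chain length `r` at each `t` (one or two coloops): `1` throughout. -/
def rrTenEight1 (t : ℕ) : ℕ := [0, 1, 1, 1, 1, 1, 1, 1, 1, 1, 1, 1, 1, 1].getD t 0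

/-- **THE CELL `(10, 8)`**: an `e`-free core of rank `10` with `18` points satisfies `RLS` at level `4`. -/
theorem c025_core_ten_eight (M : Matroid α) [M.Finite] (hR : M.eRank = (10 : ℕ)) (hn : M.E.ncard = 18)
    (hfree : ∀ e ∈ M.E, ∃ A ⊆ M.E \ {e}, e ∉ M.closure A ∧ e ∉ M.closure ((M.E \ {e}) \ A)) :
    ThmN.RLS M 10 4 := by
  rcases (show M.coloops.ncard = 0 ∨ M.coloops.ncard = 1 ∨ M.coloops.ncard = 2 ∨ 3 ≤ M.coloops.ncard by omega)
    with h | h | h | h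
  · exact rls_of_ladder_case_chain_conull M (p := 10) (c := 0) (d := 8) (by norm_num) (by norm_num) hR hn hfree h
      (by norm_num) (by norm_num) (P := 13) (S := 73) (S5 := 555) (by decide) (gb_cap_eight 10 18 73 rfl (by decide))
      (by decide) rrTenEight0 (by decide) (by decide +kernel) (by decide +kernel) (by decide +kernel)
  · exact rls_of_ladder_case_chain_conull M (p := 9) (c := 1) (d := 8) (by norm_num) (by norm_num) hR hn hfree h
      (by norm_num) (by norm_num) (P := 13) (S := 79) (S5 := 568) (by decide) (gb_cap_eight 9 17 79 rfl (by decide))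
      (by decide) rrTenEight1 (by decide) (by decide +kernel) (by decide +kernel) (by decide +kernel)
  · exact rls_of_ladder_case_chain_conull M (p := 8) (c := 2) (d := 8) (by norm_num) (by norm_num) hR hn hfree h
      (by norm_num) (by norm_num) (P := 13) (S := 88) (S5 := 583) (by decide) (gb_cap_eight 8 16 88 rfl (by decide))
      (by decide) rrTenEight1 (by decide) (by decide +kernel) (by decide +kernel) (by decide +kernel)
  · exact rls_of_coloops_lossy M (p := 7) (c := 3) (hR.trans (by norm_num)) (by norm_num) h phiK_ten_four_le

end S1

end PercRepro
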